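import Summits.Ventures.QEC.Census.CertChunks
import Summits.Ventures.QEC.Census.HB.HB40.Cert
import HarnessLib

/-!
# `HB40` — KERNEL-tier lower-bound replay, side Z, leaf file 1/1 (emitted by qec-search-7)

Bruteforce replay (CERT-FORMAT v1 §5.1, lemma L3) of the certificate `db5cfb0c6d1a344e`: every Z-type operator of weight
`1 … 5` has nonzero syndrome (rows `cert.HX`) or is allow-listed (allow-list [3146753, 206158495745, 6293506, 412316991490, 12587012, 824633982980, 25174024, 550830080008, 3221226512, 50348048, 6442453024, 100696096, 12884906048, 201392192, 25769812096, 402784384, 51539624192, 805568768, 103079248384, 538444288]). This file holds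
5 packed chunk evaluations (`chunk1R`/`chunk2R` of `Census/CertChunks.lean` over `posList 40 cert.HX`), total
760098 scan end points, each closed by `decide +kernel` — tier KERNEL (CERTIFIED): axioms ⊆ {propext, Classical.choice,
Quot.sound}. Assembled in `HB/HB40/KernelZ.lean`. Do not edit; re-emit (HOME/census/search-7/emit_kernel.py).
-/

namespace Summit.Ventures.QEC.Census.HB40

/-- Level-1 chunks `i`, `0 ≤ i < 2`, side Z of `HB40` (175164 end points): pass. -/
theorem kZ1_0 : chunk1R (leafTest [3146753, 206158495745, 6293506, 412316991490, 12587012, 824633982980, 25174024, 550830080008, 3221226512, 50348048, 6442453024, 100696096, 12884906048, 201392192, 25769812096, 402784384, 51539624192, 805568768, 103079248384, 538444288]) (posList 40 cert.HX) 4 0 2 = true := by decide +kernel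

/-- Level-1 chunks `i`, `2 ≤ i < 4`, side Z of `HB40` (141231 end points): pass. -/
theorem kZ1_2 : chunk1R (leafTest [3146753, 206158495745, 6293506, 412316991490, 12587012, 824633982980, 25174024, 550830080008, 3221226512, 50348048, 6442453024, 100696096, 12884906048, 201392192, 25769812096, 402784384, 51539624192, 805568768, 103079248384, 538444288]) (posList 40 cert.HX) 4 2 2 = true := by decide +kernel

/-- Level-1 chunks `i`, `4 ≤ i < 7`, side Z of `HB40` (159430 end points): pass. -/
theorem kZ1_4 : chunk1R (leafTest [3146753, 206158495745, 6293506, 412316991490, 12587012, 824633982980, 25174024, 550830080008, 3221226512, 50348048, 6442453024, 100696096, 12884906048, 201392192, 25769812096, 402784384, 51539624192, 805568768, 103079248384, 538444288]) (posList 40 cert.HX) 4 4 3 = true := by decide +kernel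

/-- Level-1 chunks `i`, `7 ≤ i < 13`, side Z of `HB40` (182690 end points): pass. -/
theorem kZ1_7 : chunk1R (leafTest [3146753, 206158495745, 6293506, 412316991490, 12587012, 824633982980, 25174024, 550830080008, 3221226512, 50348048, 6442453024, 100696096, 12884906048, 201392192, 25769812096, 402784384, 51539624192, 805568768, 103079248384, 538444288]) (posList 40 cert.HX) 4 7 6 = true := by decide +kernel

/-- Level-1 chunks `i`, `13 ≤ i < 40`, side Z of `HB40` (101583 end points): pass. -/
theorem kZ1_13 : chunk1R (leafTest [3146753, 206158495745, 6293506, 412316991490, 12587012, 824633982980, 25174024, 550830080008, 3221226512, 50348048, 6442453024, 100696096, 12884906048, 201392192, 25769812096, 402784384, 51539624192, 805568768, 103079248384, 538444288]) (posList 40 cert.HX) 4 13 27 = true := by decide +kernel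

end Summit.Ventures.QEC.Census.HB40
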